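import Summits.QuantumFields.YangMills.Theorems.BalabanUVNodesN15KingModelAnalyticBlockCovCauchy
import Summits.QuantumFields.YangMills.Theorems.BalabanUVNodesN15KingModelAnalyticBlockCovNorm
import Summits.QuantumFields.YangMills.Theorems.BalabanUVNodesN15KingModelComplexLinkOperatorNorm
import Literature.MathematicalPhysics.QuantumFieldTheory.King1986.UniformDecay
import HarnessLib

/-!
# BalabanUVNodes ∕ N15 — THE KING-MODEL RUNG (PART Ϫ-f, `𝕜 = ℂ`): THE CONTINUED BLOCK-FIELD COVARIANCE AND KING's CONTINUED EFFECTIVE LAPLACIAN ARE STRICTLY ACCRETIVE IN A `Θ(η)`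
# POLYDISC AROUND EVERY UNITARY BACKGROUND — the block Schur test (PART Ϛ-l) on PART Ϫ-e's Lipschitz-with-decay turns the block decay of the difference (Lemma 4.5 (4.38)'s shape) into the OPERATOR-NORM Lipschitz bound
# `‖C(U,U⁻¹) − C(U₀)‖ ≤ ℓ(m²,d)·(Lε∕s₀(m²,0,d))`, `ℓ = (16∕m²)e³K_{d+1}(ctRate(m²∕2,0,d))`; with PART Ϥ-k's floor `Re⟨f,C(U₀)f⟩ ≥ a⁻¹‖f‖²` this gives ★★★★
# `Re⟨f, C(U,U⁻¹)f⟩ ≥ (a⁻¹ − ℓ·Lε∕s₀)‖f‖²`, and through the Woodbury inversion and PART Ϫ-c's `‖C‖ ≤ a⁻¹ + 4e∕m²` ★★★★ `Re⟨g, Δ_eff(U,U⁻¹)g⟩ ≥ (a⁻¹∕2)(a⁻¹ + 4e∕m²)⁻²‖g‖²` once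
# `ℓ·Lε∕s₀ ≤ a⁻¹∕2` — the quadratic form of the block-field Gaussian keeps a positive real part under complexification of the background (every curvature)
# (Track A, DAG node N15 = NE2; FAN-OUT v1.1 §N15 s3 «KING-MODEL RUNG … + what the curved case adds»; count-neutral)

HONEST FRAMING.  Count-neutral (cell `pub-ymgap`, seat `pub-ymgap-dag-n15-e` g52; `--supports stmt-QuantumFields-27247 --as helper` = K3ᴬ, KEY MAP v3).  King's one-level comparison model,
massive fine covariance, fibre `ℂⁿ`, King's scaling, comb-depth contours; `K_{d+1}` is the tree's lattice-sum constant `B4Sect5Proof.latticeConst (d+1)` (`King1986.Torus.tdistT_sumBound`), so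
`ℓ` depends on `(m², d)` only — a crude but `η`-uniform modulus.  The accretivity window `ℓ·Lε ≤ s₀a⁻¹∕2` is again `Θ(η)` with constants `(m²,a,d)`.  NOT Bałaban's multi-level objects;
NOT a node discharge (N15 of record untouched); nothing continuum ∕ ℝ⁴ ∕ OS ∕ Clay.

ERRATUM-Ϫ1 (v1.1, DOC-ONLY; ref-I READ-1090 N1, verified first-hand on the held page p.674 of [King1986]): (4.32) defines `C^{(k)}_Ω(s)`; the sentence after it states that `C^{(k)}_Ω(s)` «has uniform exponential decay» once (4.33) (the lower bound `C ≥ γ₀I`) and (4.34) (decay of `C⁻¹`) hold; (4.35)–(4.37) are the momentum sums proving (4.33); Lemma 4.5 = (4.38) is the two-spacing difference WITH decay; (4.44) p.675 is the resolvent∕Woodbury-type difference identity and (4.45) its Fourier representation.  v1.0 of this file cited «(4.37)» for the decay of `C^{(k)}` and «(4.45)» for the Woodbury form ∕ floors; v1.1 cites (4.32)–(4.34) for the decay, (4.38) for Lipschitz-with-decay shapes, (4.33) for lower bounds ∕ floors and (4.44) for the Woodbury form.  Declarations byte-identical to v1.0.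

THE RESULTS:
* §1 TOOLS ON THE BLOCK TORUS: `re_quadForm_ge_neg_l2_opNorm` (`−‖X‖‖f‖² ≤ Re⟨f,Xf⟩`), ★ `l2_opNorm_le_of_blk_decay` (block decay `c·e^{−r d_M}` ⟹ `‖S‖ ≤ c·K_{d+1}(r)`, the symmetric Schur test),
  def **`covLip m² d = (16∕m²)e³K_{d+1}(ctRate(m²∕2,0,d))`**, `covLip_nonneg`.
* §2 ★★★ **`l2_opNorm_cxBlockCov_sub_le_eta_uniform`** (complex `U`, `‖U−U₀‖ ≤ ε`, `0 < ε`, `2Lε ≤ s₀(m²,0,d)`: `‖C(U,U⁻¹) − C(U₀,U₀⁻¹)‖ ≤ covLip·(Lε∕s₀(m²,0,d))`), ★★★ `l2_opNorm_effLapU_inv_sub_le_eta_uniform`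
  (unitary endpoints: `‖(Δ_eff(U₁))⁻¹ − (Δ_eff(U₀))⁻¹‖ ≤` the same — King's `C^{(K)}` Lipschitz in the background in operator norm on Bałaban's scale; PART Ϧ-l's bound is the other route).
* §3 ★★★★ **`re_quadForm_cxBlockCov_ge`** (`(a⁻¹ − covLip·Lε∕s₀)‖f‖² ≤ Re⟨f,C(U,U⁻¹)f⟩`), ★★★ `re_quadForm_cxBlockCov_ge_half` (`covLip·Lε∕s₀ ≤ a⁻¹∕2` ⟹ `a⁻¹∕2·‖f‖² ≤ Re⟨f,C(U,U⁻¹)f⟩`),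
  ★★ `re_eigenvalue_cxBlockCov_ge` (every eigenvalue of `C(U,U⁻¹)` has `Re μ ≥ a⁻¹∕2`).
* §4 ★★★★ **`re_quadForm_cxEffLap_ge`** (`2Lε ≤ s₀(m²,a,d)`, `covLip·Lε∕s₀(m²,0,d) ≤ a⁻¹∕2` ⟹ `(a⁻¹∕2)∕(a⁻¹ + 4e∕m²)²·‖g‖² ≤ Re⟨g,Δ_eff(U,U⁻¹)g⟩` — KING's CONTINUED EFFECTIVE LAPLACIAN IS STRICTLY
  ACCRETIVE), ★★ `re_eigenvalue_cxEffLap_ge`, ★★ `norm_eigenvalue_cxEffLap_ge` (`|μ| ≥` the same), ★★ `norm_eigenvalue_cxEffLap_le` (`|μ| ≤ ‖Δ_eff(U,U⁻¹)‖`).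
PRIOR TREE ART (by name): Ϫ-a (`cxBlockCov`, `cxBlockCov_inv_of_unitary`, `cxBlockCov_mul_cxEffLap`), Ϫ-b (`sliceRadius_anti`, `mass_coercive_fullOpU`, `isUnit_cxFullOp_zero_at_massRadius`), Ϫ-c (`l2_opNorm_cxBlockCov_at_massRadius_le`),
Ϫ-e (`norm_blk_cxBlockCov_sub_le_eta_uniform`), Ϥ-k (`re_quadForm_effLapU_inv_ge`), Ϛ-l (`l2_opNorm_le_of_blk_symm`), Ϩ-g (`sliceRadius_pos`, `isUnit_cxFullOp_at_radius`), King1986 (`Torus.tdistT_sumBound`, `tdistT_symm`),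
B4 (`latticeConst`, `latticeConst_nonneg`), Mathlib (`Matrix.star_dotProduct`, `RCLike.conj_re`, `Matrix.l2_opNorm_mulVec`).  Dedup (rg at filing): basename 0 files; needles `covLip|re_quadForm_cxBlockCov_ge|re_quadForm_cxEffLap_ge|l2_opNorm_le_of_blk_decay`
0 tree files.  Locators: [King1986] (4.32)–(4.34) p.674 (decay of `C^{(k)}`), (4.33) p.674 (floor), Lemma 4.5 (4.38) p.674, (4.44) p.675; [Balaban1985BackgroundPropagators] Thm 3.4 p.400, (3.46) p.398; [Balaban1984PropagatorsI] (1.29) p.23.  0 `sorry`, 1 `def`.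
-/

noncomputable section
open scoped BigOperators ComplexConjugate ComplexOrder Matrix.Norms.L2Operator
open Finset Matrix WithLp

namespace Summit.QuantumFields.YangMills.BalabanUVNodes.N15KingModelRung.Analytic

open Literature.MathematicalPhysics.QuantumFieldTheory.LatticeDiamagneticInequality (blk)
open Literature.MathematicalPhysics.QuantumFieldTheory.Balaban1983to89 (B4Sect5Proof.latticeConst B4Sect5Proof.latticeConst_nonneg)
open Literature.MathematicalPhysics.QuantumFieldTheory.Balaban1983to89.B5Prop11Plancherel (Tor fine)
open Literature.MathematicalPhysics.QuantumFieldTheory.King1986.Torus (tdistT tdistT_symm tdistT_sumBound)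
open Summit.QuantumFields.YangMills.BalabanUVNodes.N15KingModelRung.Covariant (fib sum_norm_fib_sq norm_star_dotProduct_le l2_opNorm_le_of_blk_symm)
open Summit.QuantumFields.YangMills.BalabanUVNodes.N15KingModelRung.CovariantBlock (BlockTree covQ fullOpU effLapU re_quadForm_effLapU_inv_ge)
open Summit.QuantumFields.YangMills.BalabanUVNodes.N15KingModelRung.CombesThomas (ctRate ctRate_pos ctRate_nonneg)

variable {d : ℕ} {L : ℕ} [NeZero L] (T : BlockTree d L) (M : Fin (d + 1) → ℕ) [hM : ∀ μ, NeZero (M μ)]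
variable {n : Type*} [Fintype n] [DecidableEq n]

/-! ## §1 Tools on the block torus: forms against operator norms, the symmetric Schur test with exponential profile -/

section Tools

variable {𝕜 : Type*} [RCLike 𝕜]

omit [NeZero L] in
/-- `−‖X‖·‖f‖² ≤ Re⟨f, Xf⟩` on the block lattice (Cauchy–Schwarz and the operator norm). [folklore] -/
theorem re_quadForm_ge_neg_l2_opNorm (X : Matrix (Tor M × n) (Tor M × n) 𝕜) (f : Tor M × n → 𝕜) :
    -(‖X‖ * ‖(toLp 2 f : EuclideanSpace 𝕜 (Tor M × n))‖ ^ 2) ≤ RCLike.re (star f ⬝ᵥ (X *ᵥ f)) := by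
  have h1 : ‖star f ⬝ᵥ (X *ᵥ f)‖ ≤ ‖X‖ * ‖(toLp 2 f : EuclideanSpace 𝕜 (Tor M × n))‖ ^ 2 := by
    calc ‖star f ⬝ᵥ (X *ᵥ f)‖ ≤ ‖(toLp 2 f : EuclideanSpace 𝕜 (Tor M × n))‖ * ‖(toLp 2 (X *ᵥ f) : EuclideanSpace 𝕜 (Tor M × n))‖ := norm_star_dotProduct_le _ f _
      _ ≤ ‖(toLp 2 f : EuclideanSpace 𝕜 (Tor M × n))‖ * (‖X‖ * ‖(toLp 2 f : EuclideanSpace 𝕜 (Tor M × n))‖) := mul_le_mul_of_nonneg_left (Matrix.l2_opNorm_mulVec X _) (norm_nonneg _)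
      _ = ‖X‖ * ‖(toLp 2 f : EuclideanSpace 𝕜 (Tor M × n))‖ ^ 2 := by ring
  have h2 : |RCLike.re (star f ⬝ᵥ (X *ᵥ f))| ≤ ‖star f ⬝ᵥ (X *ᵥ f)‖ := RCLike.abs_re_le_norm _
  have h3 := neg_le_of_abs_le (h2.trans h1)
  linarith

omit [NeZero L] in
/-- ★ THE SYMMETRIC SCHUR TEST WITH THE EXPONENTIAL BLOCK PROFILE: `‖blk S y y′‖ ≤ c·e^{−r·d_M(y,y′)}` for all blocks (`c ≥ 0`, `r > 0`) ⟹ `‖S‖ ≤ c·K_{d+1}(r)` — uniformly in the volume.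
[cite: King1986, (4.4) p.670; Balaban1985BackgroundPropagators, (3.46) p.398] -/
theorem l2_opNorm_le_of_blk_decay {S : Matrix (Tor M × n) (Tor M × n) 𝕜} {c r : ℝ} (hc : 0 ≤ c) (hr : 0 < r) (hS : ∀ y y', ‖blk S y y'‖ ≤ c * Real.exp (-(r * tdistT M y y'))) :
    ‖S‖ ≤ c * B4Sect5Proof.latticeConst (d + 1) r := by
  have hrow : ∀ y, ∑ y', c * Real.exp (-(r * tdistT M y y')) ≤ c * B4Sect5Proof.latticeConst (d + 1) r := fun y => by
    rw [← Finset.mul_sum]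
    exact mul_le_mul_of_nonneg_left (tdistT_sumBound M r hr y) hc
  have hcol : ∀ y', ∑ y, c * Real.exp (-(r * tdistT M y y')) ≤ c * B4Sect5Proof.latticeConst (d + 1) r := fun y' => by
    have e : ∑ y, c * Real.exp (-(r * tdistT M y y')) = ∑ y, c * Real.exp (-(r * tdistT M y' y)) := Finset.sum_congr rfl fun y _ => by rw [tdistT_symm M y y']
    rw [e]
    exact hrow y'
  exact l2_opNorm_le_of_blk_symm M hS hrow hcol

/-- THE LIPSCHITZ MODULUS OF NE2's UNIT LAYER IN OPERATOR NORM (per unit of `Lε∕s₀(m²,0,d)`): `covLip m² d = (16∕m²)·e³·K_{d+1}(ctRate(m²∕2,0,d))` — a function of `(m², d)` only.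
[cite: King1986, Lemma 4.5 (4.38) p.674; Balaban1985BackgroundPropagators, Thm 3.4 p.400] -/
def covLip (m2 : ℝ) (d : ℕ) : ℝ := 16 / m2 * Real.exp 3 * B4Sect5Proof.latticeConst (d + 1) (ctRate (m2 / 2) 0 d)

omit [NeZero L] hM [Fintype n] [DecidableEq n] in
/-- `covLip m² d ≥ 0` for `m² > 0`. [folklore] -/
theorem covLip_nonneg {m2 : ℝ} (hm : 0 < m2) (d : ℕ) : 0 ≤ covLip m2 d := by
  unfold covLip
  exact mul_nonneg (by positivity) (B4Sect5Proof.latticeConst_nonneg _ (ctRate_nonneg _ _ _))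

end Tools

/-! ## §2 Operator-norm Lipschitz on Bałaban's scale -/

section Lipschitz

variable (hD : ∀ j, T.depth j ≤ (d + 1) * (L - 1)) {a m2 : ℝ} (hm : 0 < m2) (hL : 1 ≤ L)
variable {U₀ U : Tor (fine L M) × Fin (d + 1) → Matrix n n ℂ} (hU₀ : ∀ bd, U₀ bd ∈ Matrix.unitaryGroup n ℂ)
variable {ε : ℝ} (hε : 0 < ε) (hU : ∀ bd, ‖U bd - U₀ bd‖ ≤ ε) (h2 : 2 * ((L : ℝ) * ε) ≤ sliceRadius m2 0 d)
include hD hm hL hU₀ hε hU h2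

/-- ★★★ **THE CONTINUED COVARIANCE IS LIPSCHITZ IN THE BACKGROUND IN OPERATOR NORM ON BAŁABAN's SCALE**: complex `U` with `‖U_b − U₀_b‖ ≤ ε`, `0 < ε`, `2Lε ≤ s₀(m²,0,d)`:
`‖C(U,U⁻¹) − C(U₀,U₀⁻¹)‖ ≤ covLip(m²,d)·(Lε∕s₀(m²,0,d))`. [cite: King1986, Lemma 4.5 (4.38) p.674, (4.44) p.675; Balaban1985BackgroundPropagators, Thm 3.4 p.400, (3.46) p.398] -/
theorem l2_opNorm_cxBlockCov_sub_le_eta_uniform :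
    ‖cxBlockCov T M a ((L : ℝ) ^ 2) m2 U (fun bd => (U bd)⁻¹) - cxBlockCov T M a ((L : ℝ) ^ 2) m2 U₀ (fun bd => (U₀ bd)⁻¹)‖ ≤ covLip m2 d * ((L : ℝ) * ε / sliceRadius m2 0 d) := by
  have hs0 : 0 < sliceRadius m2 0 d := sliceRadius_pos hm le_rfl d
  have hc : 0 ≤ 16 / m2 * Real.exp 3 * ((L : ℝ) * ε / sliceRadius m2 0 d) := by positivity
  have h := l2_opNorm_le_of_blk_decay M hc (ctRate_pos (by positivity : 0 < m2 / 2) le_rfl d) (norm_blk_cxBlockCov_sub_le_eta_uniform T M hD hm hL hU₀ hε hU h2 (a := a))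
  refine h.trans (le_of_eq ?_)
  unfold covLip; ring

/-- ★★★ **KING's `C^{(K)}(U) = (Δ_eff(U))⁻¹` IS LIPSCHITZ IN THE BACKGROUND IN OPERATOR NORM ON BAŁABAN's SCALE** (unitary `U₀, U₁`, any curvature; `a > 0`):
`‖(Δ_eff(U₁))⁻¹ − (Δ_eff(U₀))⁻¹‖ ≤ covLip(m²,d)·(Lε∕s₀(m²,0,d))`. [cite: King1986, (2.14) p.653, Lemma 4.5 (4.38) p.674; Balaban1985BackgroundPropagators, Thm 3.4 p.400] -/
theorem l2_opNorm_effLapU_inv_sub_le_eta_uniform (ha : 0 < a) (hU₁ : ∀ bd, U bd ∈ Matrix.unitaryGroup n ℂ) :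
    ‖(effLapU T M a ((L : ℝ) ^ 2) m2 U)⁻¹ - (effLapU T M a ((L : ℝ) ^ 2) m2 U₀)⁻¹‖ ≤ covLip m2 d * ((L : ℝ) * ε / sliceRadius m2 0 d) := by
  rw [← cxBlockCov_inv_of_unitary T M ha (by positivity) hm hU₁, ← cxBlockCov_inv_of_unitary T M ha (by positivity) hm hU₀]
  exact l2_opNorm_cxBlockCov_sub_le_eta_uniform T M hD hm hL hU₀ hε hU h2

/-! ## §3 Accretivity of the continued covariance -/

/-- ★★★★ **THE CONTINUED BLOCK-FIELD COVARIANCE IS ACCRETIVE UP TO THE LIPSCHITZ DEFECT**: `a > 0`, complex `U` within `ε` of the unitary `U₀`, `2Lε ≤ s₀(m²,0,d)`: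
`(a⁻¹ − covLip·Lε∕s₀(m²,0,d))·‖f‖² ≤ Re⟨f, C(U,U⁻¹)f⟩` for every block field `f` (PART Ϥ-k's noise floor at `U₀` minus the operator-norm Lipschitz defect).
[cite: King1986, (4.33) p.674, (4.44) p.675; Balaban1985BackgroundPropagators, (3.25) p.394, Thm 3.4 p.400] -/
theorem re_quadForm_cxBlockCov_ge (ha : 0 < a) (f : Tor M × n → ℂ) :
    (a⁻¹ - covLip m2 d * ((L : ℝ) * ε / sliceRadius m2 0 d)) * ‖(toLp 2 f : EuclideanSpace ℂ (Tor M × n))‖ ^ 2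
      ≤ RCLike.re (star f ⬝ᵥ (cxBlockCov T M a ((L : ℝ) ^ 2) m2 U (fun bd => (U bd)⁻¹) *ᵥ f)) := by
  set C := cxBlockCov T M a ((L : ℝ) ^ 2) m2 U (fun bd => (U bd)⁻¹) with hC
  set C₀ := cxBlockCov T M a ((L : ℝ) ^ 2) m2 U₀ (fun bd => (U₀ bd)⁻¹) with hC₀
  have hfloor : a⁻¹ * ‖(toLp 2 f : EuclideanSpace ℂ (Tor M × n))‖ ^ 2 ≤ RCLike.re (star f ⬝ᵥ (C₀ *ᵥ f)) := by
    rw [hC₀, cxBlockCov_inv_of_unitary T M ha (by positivity) hm hU₀]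
    exact re_quadForm_effLapU_inv_ge T M ha (by positivity) hm hU₀ f
  have hdef := re_quadForm_ge_neg_l2_opNorm M (C - C₀) f
  have hlip := l2_opNorm_cxBlockCov_sub_le_eta_uniform T M hD hm hL hU₀ hε hU h2 (a := a)
  have hsplit : star f ⬝ᵥ (C *ᵥ f) = star f ⬝ᵥ (C₀ *ᵥ f) + star f ⬝ᵥ ((C - C₀) *ᵥ f) := by
    rw [Matrix.sub_mulVec, dotProduct_sub]; ring
  rw [hsplit, map_add]
  have hN : 0 ≤ ‖(toLp 2 f : EuclideanSpace ℂ (Tor M × n))‖ ^ 2 := sq_nonneg _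
  nlinarith [mul_le_mul_of_nonneg_right hlip hN]

/-- ★★★ **IN THE ACCRETIVITY WINDOW HALF THE NOISE SURVIVES**: if moreover `covLip·Lε∕s₀(m²,0,d) ≤ a⁻¹∕2` then `(a⁻¹∕2)·‖f‖² ≤ Re⟨f, C(U,U⁻¹)f⟩`. [cite: King1986, (4.33) p.674; Balaban1985BackgroundPropagators, Thm 3.4 p.400] -/
theorem re_quadForm_cxBlockCov_ge_half (ha : 0 < a) (hsmall : covLip m2 d * ((L : ℝ) * ε / sliceRadius m2 0 d) ≤ a⁻¹ / 2) (f : Tor M × n → ℂ) :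
    a⁻¹ / 2 * ‖(toLp 2 f : EuclideanSpace ℂ (Tor M × n))‖ ^ 2 ≤ RCLike.re (star f ⬝ᵥ (cxBlockCov T M a ((L : ℝ) ^ 2) m2 U (fun bd => (U bd)⁻¹) *ᵥ f)) := by
  have h := re_quadForm_cxBlockCov_ge T M hD hm hL hU₀ hε hU h2 ha f
  have hN : 0 ≤ ‖(toLp 2 f : EuclideanSpace ℂ (Tor M × n))‖ ^ 2 := sq_nonneg _
  nlinarith

omit [DecidableEq n] hD hm hL hU₀ hε hU h2 in
/-- EIGENVALUES SIT IN THE NUMERICAL RANGE: `Xv = μv`, `v ≠ 0`, `β‖f‖² ≤ Re⟨f,Xf⟩` for all `f` ⟹ `β ≤ Re μ`. [folklore] -/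
theorem re_eigenvalue_ge_of_quadForm {X : Matrix (Tor M × n) (Tor M × n) ℂ} {β : ℝ} (hX : ∀ f : Tor M × n → ℂ, β * ‖(toLp 2 f : EuclideanSpace ℂ (Tor M × n))‖ ^ 2 ≤ RCLike.re (star f ⬝ᵥ (X *ᵥ f)))
    {μ : ℂ} {v : Tor M × n → ℂ} (hv : v ≠ 0) (hXv : X *ᵥ v = μ • v) : β ≤ μ.re := by
  have h := hX v
  rw [hXv, dotProduct_smul, smul_eq_mul, RCLike.re_eq_complex_re, Complex.mul_re] at h
  have hvv : star v ⬝ᵥ v = ((‖(toLp 2 v : EuclideanSpace ℂ (Tor M × n))‖ ^ 2 : ℝ) : ℂ) := by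
    rw [EuclideanSpace.norm_sq_eq, ← Literature.LinearAlgebra.Matrix.RayleighQuotient.re_star_dotProduct_self]
    have him : (star v ⬝ᵥ v).im = 0 := by
      rw [← Complex.conj_eq_iff_im, ← Complex.star_def, ← Matrix.star_dotProduct_star]; simp only [star_star]
    exact Complex.ext (by simp) (by simp [him])
  rw [hvv, Complex.ofReal_re, Complex.ofReal_im, mul_zero, sub_zero] at h
  have hpos : 0 < ‖(toLp 2 v : EuclideanSpace ℂ (Tor M × n))‖ ^ 2 := by
    have : (toLp 2 v : EuclideanSpace ℂ (Tor M × n)) ≠ 0 := fun h0 => hv (by simpa using congrArg ofLp h0)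
    positivity
  nlinarith

/-- ★★ **THE SPECTRUM OF THE CONTINUED COVARIANCE LIES IN `Re μ ≥ a⁻¹∕2`** in the accretivity window. [cite: King1986, (4.33) p.674; Balaban1985BackgroundPropagators, Thm 3.4 p.400] -/
theorem re_eigenvalue_cxBlockCov_ge (ha : 0 < a) (hsmall : covLip m2 d * ((L : ℝ) * ε / sliceRadius m2 0 d) ≤ a⁻¹ / 2) {μ : ℂ} {v : Tor M × n → ℂ} (hv : v ≠ 0)
    (hCv : cxBlockCov T M a ((L : ℝ) ^ 2) m2 U (fun bd => (U bd)⁻¹) *ᵥ v = μ • v) : a⁻¹ / 2 ≤ μ.re :=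
  re_eigenvalue_ge_of_quadForm M (re_quadForm_cxBlockCov_ge_half T M hD hm hL hU₀ hε hU h2 ha hsmall) hv hCv

end Lipschitz

/-! ## §4 Accretivity of King's continued effective Laplacian -/

section EffLap

variable (hD : ∀ j, T.depth j ≤ (d + 1) * (L - 1)) {a m2 : ℝ} (ha : 0 < a) (hm : 0 < m2) (hL : 1 ≤ L)
variable {U₀ U : Tor (fine L M) × Fin (d + 1) → Matrix n n ℂ} (hU₀ : ∀ bd, U₀ bd ∈ Matrix.unitaryGroup n ℂ)
variable {ε : ℝ} (hε : 0 < ε) (hU : ∀ bd, ‖U bd - U₀ bd‖ ≤ ε) (h2a : 2 * ((L : ℝ) * ε) ≤ sliceRadius m2 a d)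
variable (hsmall : covLip m2 d * ((L : ℝ) * ε / sliceRadius m2 0 d) ≤ a⁻¹ / 2)
include hD ha hm hL hU₀ hε hU h2a hsmall

omit [NeZero L] hD hL hU₀ hU hsmall in
/-- The accretivity window implies both earlier windows: `2Lε ≤ s₀(m²,0,d)` and `Lε ≤ s₀(m²,a,d)`. [folklore] -/
theorem windows_of_h2a : 2 * ((L : ℝ) * ε) ≤ sliceRadius m2 0 d ∧ (L : ℝ) * ε ≤ sliceRadius m2 a d := by
  have hLε : 0 ≤ (L : ℝ) * ε := mul_nonneg (Nat.cast_nonneg L) hε.le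
  exact ⟨h2a.trans (sliceRadius_anti hm.le ha.le d), by linarith⟩

/-- ★★★★ **KING's CONTINUED EFFECTIVE LAPLACIAN IS STRICTLY ACCRETIVE IN A `Θ(η)` POLYDISC AROUND EVERY UNITARY BACKGROUND**: complex `U` with `‖U_b − U₀_b‖ ≤ ε`, `0 < ε`,
`2Lε ≤ s₀(m²,a,d)`, `covLip(m²,d)·Lε∕s₀(m²,0,d) ≤ a⁻¹∕2`:  `(a⁻¹∕2)∕(a⁻¹ + 4e∕m²)²·‖g‖² ≤ Re⟨g, Δ_eff(U,U⁻¹)g⟩` for every block field `g` — via `g = C(U,U⁻¹)h`, `h = Δ_eff g`: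
`Re⟨g,Δ_eff g⟩ = Re⟨h, C h⟩ ≥ (a⁻¹∕2)‖h‖²` and `‖g‖ ≤ ‖C‖‖h‖`. [cite: King1986, (2.14) p.653, (4.33) p.674, (4.44) p.675; Balaban1985BackgroundPropagators, Thm 3.4 p.400] -/
theorem re_quadForm_cxEffLap_ge (g : Tor M × n → ℂ) :
    (a⁻¹ / 2) / (a⁻¹ + 4 / m2 * Real.exp 1) ^ 2 * ‖(toLp 2 g : EuclideanSpace ℂ (Tor M × n))‖ ^ 2
      ≤ RCLike.re (star g ⬝ᵥ (cxEffLap T M a ((L : ℝ) ^ 2) m2 U (fun bd => (U bd)⁻¹) *ᵥ g)) := by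
  obtain ⟨h2, hrad⟩ := windows_of_h2a (L := L) ha hm hε h2a
  set C := cxBlockCov T M a ((L : ℝ) ^ 2) m2 U (fun bd => (U bd)⁻¹) with hC
  set Δ := cxEffLap T M a ((L : ℝ) ^ 2) m2 U (fun bd => (U bd)⁻¹) with hΔ
  set Γ : ℝ := a⁻¹ + 4 / m2 * Real.exp 1 with hΓ
  have hΓ0 : 0 < Γ := by positivity
  -- `C·Δ = 1`
  have hCΔ : C * Δ = 1 := cxBlockCov_mul_cxEffLap T M ha.ne'
    (isUnit_cxFullOp_at_radius T M hD ha.le hm.le hL hU₀ hm (mass_coercive_fullOpU T M ha.le (by positivity) m2 hU₀) hε.le hU hrad)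
    (isUnit_cxFullOp_zero_at_massRadius T M hD ha hm hL hU₀ hε.le hU hrad)
  obtain ⟨h, hh⟩ : ∃ h : Tor M × n → ℂ, h = Δ *ᵥ g := ⟨_, rfl⟩
  have hg : C *ᵥ h = g := by rw [hh, Matrix.mulVec_mulVec, hCΔ, Matrix.one_mulVec]
  -- `Re⟨g, Δg⟩ = Re⟨h, Ch⟩`
  have hform : RCLike.re (star g ⬝ᵥ (Δ *ᵥ g)) = RCLike.re (star h ⬝ᵥ (C *ᵥ h)) := by
    have e1 : star g ⬝ᵥ (Δ *ᵥ g) = star (C *ᵥ h) ⬝ᵥ h := by rw [hg, ← hh]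
    rw [e1, Matrix.star_dotProduct (C *ᵥ h) h, RCLike.star_def, RCLike.conj_re]
  -- `‖g‖ ≤ Γ‖h‖`
  have hCop : ‖C‖ ≤ Γ := l2_opNorm_cxBlockCov_at_massRadius_le T M hD ha hm hL hU₀ hε.le hU hrad
  have hmv : ‖(toLp 2 (C *ᵥ h) : EuclideanSpace ℂ (Tor M × n))‖ ≤ ‖C‖ * ‖(toLp 2 h : EuclideanSpace ℂ (Tor M × n))‖ :=
    Matrix.l2_opNorm_mulVec C (toLp 2 h : EuclideanSpace ℂ (Tor M × n))
  have hnorm : ‖(toLp 2 g : EuclideanSpace ℂ (Tor M × n))‖ ≤ Γ * ‖(toLp 2 h : EuclideanSpace ℂ (Tor M × n))‖ := by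
    rw [← hg]
    exact hmv.trans (mul_le_mul_of_nonneg_right hCop (norm_nonneg _))
  have hC' := re_quadForm_cxBlockCov_ge_half T M hD hm hL hU₀ hε hU h2 ha hsmall h
  rw [hform]
  have hsq : ‖(toLp 2 g : EuclideanSpace ℂ (Tor M × n))‖ ^ 2 ≤ Γ ^ 2 * ‖(toLp 2 h : EuclideanSpace ℂ (Tor M × n))‖ ^ 2 := by
    rw [← mul_pow]; exact pow_le_pow_left₀ (norm_nonneg _) hnorm 2
  have ha2 : 0 ≤ a⁻¹ / 2 := by positivity
  calc (a⁻¹ / 2) / Γ ^ 2 * ‖(toLp 2 g : EuclideanSpace ℂ (Tor M × n))‖ ^ 2 ≤ (a⁻¹ / 2) / Γ ^ 2 * (Γ ^ 2 * ‖(toLp 2 h : EuclideanSpace ℂ (Tor M × n))‖ ^ 2) :=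
        mul_le_mul_of_nonneg_left hsq (by positivity)
    _ = a⁻¹ / 2 * ‖(toLp 2 h : EuclideanSpace ℂ (Tor M × n))‖ ^ 2 := by field_simp
    _ ≤ RCLike.re (star h ⬝ᵥ (C *ᵥ h)) := hC'

/-- ★★ **EVERY EIGENVALUE OF `Δ_eff(U,U⁻¹)` HAS `Re μ ≥ (a⁻¹∕2)∕(a⁻¹ + 4e∕m²)²`** in the accretivity window. [cite: King1986, (2.14) p.653; Balaban1985BackgroundPropagators, Thm 3.4 p.400] -/
theorem re_eigenvalue_cxEffLap_ge {μ : ℂ} {v : Tor M × n → ℂ} (hv : v ≠ 0) (hΔv : cxEffLap T M a ((L : ℝ) ^ 2) m2 U (fun bd => (U bd)⁻¹) *ᵥ v = μ • v) :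
    (a⁻¹ / 2) / (a⁻¹ + 4 / m2 * Real.exp 1) ^ 2 ≤ μ.re :=
  re_eigenvalue_ge_of_quadForm M (re_quadForm_cxEffLap_ge T M hD ha hm hL hU₀ hε hU h2a hsmall) hv hΔv

/-- ★★ **… HENCE `|μ| ≥ (a⁻¹∕2)∕(a⁻¹ + 4e∕m²)²`**: the spectrum of the continued effective Laplacian stays a definite distance from `0`, uniformly in the volume, the spacing and the fibre.
[cite: King1986, (2.14) p.653; Balaban1985BackgroundPropagators, Thm 3.4 p.400] -/
theorem norm_eigenvalue_cxEffLap_ge {μ : ℂ} {v : Tor M × n → ℂ} (hv : v ≠ 0) (hΔv : cxEffLap T M a ((L : ℝ) ^ 2) m2 U (fun bd => (U bd)⁻¹) *ᵥ v = μ • v) :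
    (a⁻¹ / 2) / (a⁻¹ + 4 / m2 * Real.exp 1) ^ 2 ≤ ‖μ‖ :=
  (re_eigenvalue_cxEffLap_ge T M hD ha hm hL hU₀ hε hU h2a hsmall hv hΔv).trans (Complex.re_le_norm μ)

omit hD ha hm hL hU₀ hε hU h2a hsmall in
/-- EIGENVALUES ARE BOUNDED BY THE OPERATOR NORM: `Xv = μv`, `v ≠ 0` ⟹ `|μ| ≤ ‖X‖`. [folklore] -/
theorem norm_eigenvalue_le_l2_opNorm {X : Matrix (Tor M × n) (Tor M × n) ℂ} {μ : ℂ} {v : Tor M × n → ℂ} (hv : v ≠ 0) (hXv : X *ᵥ v = μ • v) : ‖μ‖ ≤ ‖X‖ := by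
  have hpos : 0 < ‖(toLp 2 v : EuclideanSpace ℂ (Tor M × n))‖ := by
    have : (toLp 2 v : EuclideanSpace ℂ (Tor M × n)) ≠ 0 := fun h0 => hv (by simpa using congrArg ofLp h0)
    positivity
  have h := Matrix.l2_opNorm_mulVec X (toLp 2 v : EuclideanSpace ℂ (Tor M × n))
  have e : ‖(EuclideanSpace.equiv (Tor M × n) ℂ).symm (X *ᵥ ⇑(toLp 2 v : EuclideanSpace ℂ (Tor M × n)))‖ = ‖μ‖ * ‖(toLp 2 v : EuclideanSpace ℂ (Tor M × n))‖ := by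
    rw [show ⇑(toLp 2 v : EuclideanSpace ℂ (Tor M × n)) = v from rfl, hXv]
    rw [show (EuclideanSpace.equiv (Tor M × n) ℂ).symm (μ • v) = μ • (toLp 2 v : EuclideanSpace ℂ (Tor M × n)) from rfl, norm_smul]
  rw [e] at h
  exact le_of_mul_le_mul_right h hpos

omit hD ha hm hL hU₀ hε hU h2a hsmall in
/-- ★★ every eigenvalue of `Δ_eff(U,U⁻¹)` has `|μ| ≤ ‖Δ_eff(U,U⁻¹)‖`. [folklore] -/
theorem norm_eigenvalue_cxEffLap_le {μ : ℂ} {v : Tor M × n → ℂ} (hv : v ≠ 0) (hΔv : cxEffLap T M a ((L : ℝ) ^ 2) m2 U (fun bd => (U bd)⁻¹) *ᵥ v = μ • v) :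
    ‖μ‖ ≤ ‖cxEffLap T M a ((L : ℝ) ^ 2) m2 U (fun bd => (U bd)⁻¹)‖ :=
  norm_eigenvalue_le_l2_opNorm M hv hΔv

end EffLap

end Summit.QuantumFields.YangMills.BalabanUVNodes.N15KingModelRung.Analytic

end
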